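import Summits.AtomisticToContinuum.HydrodynamicLimit.Theorems.LambertianContactSwapLambertianEulerSecondMoment
import HarnessLib

/-!
# Weighted moments of the Lambert cosine law (line `Sketch` v8b, crux
# `LambertianContactSwap.ContactAngleEquidistribution`, stmt-AtomisticToContinuum-12097; lead c5)

Helper file (`--supports stmt-AtomisticToContinuum-12097`, registered stubs `stub_lambertFourthMoment_self`,
`stub_lambertWeightedMoment_unit`, `stub_lambertWeightedMixedMoment_unit`). For a unit contact normal `ω` of
`ℝ³` and a standard Gaussian vector `ξ`, the Lambertian direction `n = lambertDir ω ξ = normalize(ω + ξ̂)`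
follows the cosine law `4 (n·ω)₊ dσ(n)/(4π)` on the outgoing hemisphere. Beyond the tree's second moment
`E[⟪c, n⟫²] = ¼ (‖c‖² + ⟪c, ω⟫²)` (`…LambertianEulerSecondMoment.secondMoment_unit`) we compute

* the axial fourth moment `E[⟪ω, n⟫⁴] = ⅓` (`stub_lambertFourthMoment_self`): by the Lambert law
  (`…LambertLaw.lambertLaw`) and Archimedes' hat-box theorem (`…Archimedes.archimedesV3`) it equals
  `½ ∫_{-1}^{1} 4 t₊ t⁴ dt = ½ · ⅔`;
* the weighted second moment `F(c) = E[⟪ω, n⟫² ⟪c, n⟫²] = (‖c‖² + 3⟪c, ω⟫²)/12`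
  (`stub_lambertWeightedMoment_unit`): the weight `⟪ω, n⟫²` is invariant under every linear isometry fixing
  `ω`, so exactly as for the unweighted form `F(L c) = F(c)` (`weightedMoment_map`), `F` splits along
  reflections (`weightedMoment_split`), `F(ω) = E[⟪ω, n⟫⁴] = ⅓`, the trace
  `F(e₁) + F(e₂) + F(ω) = E[⟪ω, n⟫² ‖n‖²] = E[⟪ω, n⟫²] = ½` and `F(e₁) = F(e₂)` give `F(eᵢ) = 1/12` in the
  frame `(e₁ ω, e₂ ω, ω)` of `DicedHardSphereDynamics.Lambert`, whence
  `F(c) = ⅓ ⟪c, ω⟫² + (⟪c, e₁⟫² + ⟪c, e₂⟫²)/12`;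
* its polarisation `E[⟪ω, n⟫² ⟪a, n⟫⟪c, n⟫] = (⟪a, c⟫ + 3⟪a, ω⟫⟪c, ω⟫)/12`
  (`stub_lambertWeightedMixedMoment_unit`).

References: folklore (moments of the cosine law; e.g. C. Cercignani, R. Illner, M. Pulvirenti, *The
Mathematical Theory of Dilute Gases* (1994), App. 4.A).
-/

noncomputable section

open MeasureTheory ProbabilityTheory Set Real Filter
open scoped ENNReal RealInnerProductSpace

namespace Summit.AtomisticToContinuum.HydrodynamicLimit.Theorems.ContactAngleEquidistributionSketch

open Literature.MathematicalPhysics.KineticTheory Literature.Analysis.FluidPDE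
open Summit.AtomisticToContinuum.HydrodynamicLimit.Theorems.LambertianContactSwapLambertianEulerGaussianFrame
open Summit.AtomisticToContinuum.HydrodynamicLimit.Theorems.LambertianContactSwapLambertianEulerLambertLaw
open Summit.AtomisticToContinuum.HydrodynamicLimit.Theorems.LambertianContactSwapLambertianEulerArchimedes
open Summit.AtomisticToContinuum.HydrodynamicLimit.Theorems.LambertianContactSwapLambertianEulerSecondMoment

/-! ### The axial fourth moment `E[⟪ω, n⟫⁴] = ⅓` -/

/-- `∫_{-1}^{1} 4 t₊ t⁴ dt = ⅔`. [folklore] -/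
theorem weightedMoment_integral_weight_mul_pow_four :
    ∫ t in (-1 : ℝ)..1, 4 * max t 0 * t ^ 4 = 2 / 3 := by
  have hint : ∀ a b : ℝ, IntervalIntegrable (fun t : ℝ => 4 * max t 0 * t ^ 4) volume a b :=
    fun a b => ((continuous_const.mul (continuous_id.max continuous_const)).mul
      (continuous_pow 4)).intervalIntegrable a b
  have h1 : ∫ t in (-1 : ℝ)..0, 4 * max t 0 * t ^ 4 = 0 := by
    rw [intervalIntegral.integral_congr (g := fun _ => (0 : ℝ)) fun t ht => ?_]
    · exact intervalIntegral.integral_zero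
    · rw [uIcc_of_le (by norm_num)] at ht
      simp only [max_eq_right ht.2, mul_zero, zero_mul]
  have h2 : ∫ t in (0 : ℝ)..1, 4 * max t 0 * t ^ 4 = 2 / 3 := by
    rw [intervalIntegral.integral_congr (g := fun t : ℝ => 4 * t ^ 5) fun t ht => ?_]
    · rw [intervalIntegral.integral_const_mul, integral_pow]
      norm_num
    · rw [uIcc_of_le zero_le_one] at ht
      simp only [max_eq_left ht.1]
      ring
  rw [← intervalIntegral.integral_add_adjacent_intervals (hint (-1) 0) (hint 0 1), h1, h2,
    zero_add]

/-- `½ ∫⁻_{[-1,1]} 4 t₊ · t⁴ dt = ⅓` in `ℝ≥0∞`: the axial fourth moment of the cosine law, once the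
polar cosine is known to be uniform on `[-1, 1]`. [folklore] -/
theorem weightedMoment_lintegral_weight_mul_pow_four :
    2⁻¹ * ∫⁻ t in Icc (-1 : ℝ) 1, ENNReal.ofReal (4 * max t 0) * ENNReal.ofReal (t ^ 4) =
      3⁻¹ := by
  have hmul : ∀ t : ℝ, ENNReal.ofReal (4 * max t 0) * ENNReal.ofReal (t ^ 4) =
      ENNReal.ofReal (4 * max t 0 * t ^ 4) := fun t => (ENNReal.ofReal_mul (by positivity)).symm
  have hcont : Continuous fun t : ℝ => 4 * max t 0 * t ^ 4 :=
    (continuous_const.mul (continuous_id.max continuous_const)).mul (continuous_pow 4)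
  have hnn : ∀ t ∈ Icc (-1 : ℝ) 1, 0 ≤ 4 * max t 0 * t ^ 4 := fun t _ => by positivity
  simp_rw [hmul]
  rw [← ofReal_integral_eq_lintegral_ofReal hcont.integrableOn_Icc
      (ae_restrict_of_forall_mem measurableSet_Icc hnn), integral_Icc_eq_integral_Ioc,
    ← intervalIntegral.integral_of_le (by norm_num : (-1 : ℝ) ≤ 1),
    weightedMoment_integral_weight_mul_pow_four,
    ENNReal.ofReal_div_of_pos (by norm_num : (0 : ℝ) < 3), ENNReal.ofReal_ofNat,
    ENNReal.ofReal_ofNat, ← mul_div_assoc, ENNReal.inv_mul_cancel two_ne_zero ENNReal.ofNat_ne_top,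
    one_div]

/-- **Registered stub `stub_lambertFourthMoment_self`** (line `Sketch` v8b, crux
stmt-AtomisticToContinuum-12097) — the axial fourth moment of the cosine law: for a unit normal `ω`,
`E[⟪ω, lambertDir ω ξ⟫⁴] = ⅓`. By the Lambert law the left side is `E[4 (⟪ω, ξ̂⟫)₊ ⟪ω, ξ̂⟫⁴]`, and
`⟪ω, ξ̂⟫` is uniform on `[-1, 1]` (Archimedes), so it equals `½ ∫_0^1 4t⁵ dt = ⅓`. [folklore] -/
theorem stub_lambertFourthMoment_self {ω : V3} (hω : ‖ω‖ = 1) :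
    ∫ ξ, ⟪ω, lambertDir ω ξ⟫ ^ 4 ∂(stdGaussian V3) = 3⁻¹ := by
  have hω0 : ω ≠ 0 := fun h => by
    rw [h, norm_zero] at hω
    exact zero_ne_one hω
  have hω1 : ‖ω‖⁻¹ • ω = ω := by rw [hω, inv_one, one_smul]
  have hF : Measurable fun n : V3 => ENNReal.ofReal (⟪ω, n⟫ ^ 4) := by fun_prop
  have hm : Measurable fun ξ : V3 => ⟪ω, lambertDir ω ξ⟫ ^ 4 :=
    (measurable_const.inner (measurable_const.lambertDir measurable_id)).pow_const 4
  have hG : Measurable fun t : ℝ => ENNReal.ofReal (4 * max t 0) * ENNReal.ofReal (t ^ 4) :=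
    (ENNReal.measurable_ofReal.comp (measurable_const.mul (measurable_id.max measurable_const))).mul
      (ENNReal.measurable_ofReal.comp (measurable_id.pow_const 4))
  have hhat : ∀ ξ : V3, ⟪ω, ‖ξ‖⁻¹ • ξ⟫ = ⟪ω, ξ⟫ / ‖ξ‖ := fun ξ => by
    rw [real_inner_smul_right, div_eq_inv_mul]
  have hnn : ∀ ξ : V3, 0 ≤ ⟪ω, lambertDir ω ξ⟫ ^ 4 := fun ξ => by positivity
  have key := lambertLaw ω hω0 _ hF
  rw [hω1] at key
  rw [integral_eq_lintegral_of_nonneg_ae (Eventually.of_forall hnn) hm.aestronglyMeasurable, key]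
  simp_rw [hhat]
  rw [archimedesV3 ω hω _ hG, weightedMoment_lintegral_weight_mul_pow_four, ENNReal.toReal_inv,
    ENNReal.toReal_ofNat]

/-! ### The weighted quadratic form `F(c) = E[⟪ω, n⟫² ⟪c, n⟫²]`: integrability, parallelogram law -/

/-- The product `⟪a, lambertDir ω ξ⟫² ⟪c, lambertDir ω ξ⟫²` is bounded by `‖a‖² ‖c‖²`
(`‖lambertDir ω ξ‖ ≤ 1`), hence integrable against the standard Gaussian. [folklore] -/
theorem weightedMoment_integrable (ω a c : V3) :
    Integrable (fun ξ : V3 => ⟪a, lambertDir ω ξ⟫ ^ 2 * ⟪c, lambertDir ω ξ⟫ ^ 2) (stdGaussian V3) := by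
  have hm : Measurable fun ξ : V3 => ⟪a, lambertDir ω ξ⟫ ^ 2 * ⟪c, lambertDir ω ξ⟫ ^ 2 :=
    ((measurable_const.inner (measurable_const.lambertDir measurable_id)).pow_const 2).mul
      ((measurable_const.inner (measurable_const.lambertDir measurable_id)).pow_const 2)
  refine Integrable.of_bound hm.aestronglyMeasurable (‖a‖ ^ 2 * ‖c‖ ^ 2)
    (Eventually.of_forall fun ξ => ?_)
  have ha : |⟪a, lambertDir ω ξ⟫| ≤ ‖a‖ :=
    (abs_real_inner_le_norm a _).trans
      (mul_le_of_le_one_right (norm_nonneg a) (norm_lambertDir_le_one ω ξ))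
  have hc : |⟪c, lambertDir ω ξ⟫| ≤ ‖c‖ :=
    (abs_real_inner_le_norm c _).trans
      (mul_le_of_le_one_right (norm_nonneg c) (norm_lambertDir_le_one ω ξ))
  rw [Real.norm_eq_abs, abs_mul, abs_pow, abs_pow]
  exact mul_le_mul (pow_le_pow_left₀ (abs_nonneg _) ha 2) (pow_le_pow_left₀ (abs_nonneg _) hc 2)
    (pow_nonneg (abs_nonneg _) 2) (pow_nonneg (norm_nonneg _) 2)

/-- **Parallelogram law** of the weighted quadratic form `F(c) = E[⟪ω, n⟫² ⟪c, n⟫²]`: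
`F(a + b) + F(a - b) = 2 F(a) + 2 F(b)`. [folklore] -/
theorem weightedMoment_add_add_sub (ω a b : V3) :
    ∫ ξ, ⟪ω, lambertDir ω ξ⟫ ^ 2 * ⟪a + b, lambertDir ω ξ⟫ ^ 2 ∂(stdGaussian V3) +
        ∫ ξ, ⟪ω, lambertDir ω ξ⟫ ^ 2 * ⟪a - b, lambertDir ω ξ⟫ ^ 2 ∂(stdGaussian V3) =
      2 * ∫ ξ, ⟪ω, lambertDir ω ξ⟫ ^ 2 * ⟪a, lambertDir ω ξ⟫ ^ 2 ∂(stdGaussian V3) +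
        2 * ∫ ξ, ⟪ω, lambertDir ω ξ⟫ ^ 2 * ⟪b, lambertDir ω ξ⟫ ^ 2 ∂(stdGaussian V3) := by
  rw [← integral_add (weightedMoment_integrable ω ω _) (weightedMoment_integrable ω ω _),
    ← integral_const_mul, ← integral_const_mul,
    ← integral_add ((weightedMoment_integrable ω ω a).const_mul 2)
      ((weightedMoment_integrable ω ω b).const_mul 2)]
  refine integral_congr_ae (Eventually.of_forall fun ξ => ?_)
  simp only [inner_add_left, inner_sub_left]
  ring

/-- Homogeneity of the weighted quadratic form: `F(s c) = s² F(c)`. [folklore] -/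
theorem weightedMoment_smul (ω a : V3) (s : ℝ) :
    ∫ ξ, ⟪ω, lambertDir ω ξ⟫ ^ 2 * ⟪s • a, lambertDir ω ξ⟫ ^ 2 ∂(stdGaussian V3) =
      s ^ 2 * ∫ ξ, ⟪ω, lambertDir ω ξ⟫ ^ 2 * ⟪a, lambertDir ω ξ⟫ ^ 2 ∂(stdGaussian V3) := by
  rw [← integral_const_mul]
  refine integral_congr_ae (Eventually.of_forall fun ξ => ?_)
  simp only [real_inner_smul_left, mul_pow]
  ring

/-! ### Rotational symmetry about the contact normal -/

/-- **Invariance of the weighted quadratic form under isometries fixing the normal**: if `L` is a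
linear isometry of `ℝ³` with `L ω = ω` then `F(L c) = F(c)` — the Gaussian is `L`-invariant,
`lambertDir ω (L ξ) = L (lambertDir ω ξ)` and the weight `⟪ω, L n⟫ = ⟪ω, n⟫`. [folklore] -/
theorem weightedMoment_map {ω : V3} (L : V3 ≃ₗᵢ[ℝ] V3) (hL : L ω = ω) (c : V3) :
    ∫ ξ, ⟪ω, lambertDir ω ξ⟫ ^ 2 * ⟪L c, lambertDir ω ξ⟫ ^ 2 ∂(stdGaussian V3) =
      ∫ ξ, ⟪ω, lambertDir ω ξ⟫ ^ 2 * ⟪c, lambertDir ω ξ⟫ ^ 2 ∂(stdGaussian V3) := by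
  have hmap : (stdGaussian V3).map L = stdGaussian V3 := stdGaussian_map L
  have h := integral_map_equiv (μ := stdGaussian V3) L.toHomeomorph.toMeasurableEquiv
    (fun ξ : V3 => ⟪ω, lambertDir ω ξ⟫ ^ 2 * ⟪L c, lambertDir ω ξ⟫ ^ 2)
  have hcoe : ⇑L.toHomeomorph.toMeasurableEquiv = L := rfl
  rw [hcoe, hmap] at h
  rw [h]
  refine integral_congr_ae (Eventually.of_forall fun ξ => ?_)
  have hn : lambertDir ω (L ξ) = L (lambertDir ω ξ) := by rw [map_lambertDir_V3, hL]
  have hωL : ∀ x : V3, ⟪ω, L x⟫ = ⟪ω, x⟫ := fun x => by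
    rw [← L.inner_map_map ω x, hL]
  simp only [hn, hωL, LinearIsometryEquiv.inner_map_map]

/-- **Splitting**: if a linear isometry of `ℝ³` fixes `ω` and `a` and negates `b`, then
`F(a + b) = F(a) + F(b)` (invariance `F(a + b) = F(a - b)` and the parallelogram law). [folklore] -/
theorem weightedMoment_split {ω a b : V3} (L : V3 ≃ₗᵢ[ℝ] V3) (hL : L ω = ω) (ha : L a = a)
    (hb : L b = -b) :
    ∫ ξ, ⟪ω, lambertDir ω ξ⟫ ^ 2 * ⟪a + b, lambertDir ω ξ⟫ ^ 2 ∂(stdGaussian V3) =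
      ∫ ξ, ⟪ω, lambertDir ω ξ⟫ ^ 2 * ⟪a, lambertDir ω ξ⟫ ^ 2 ∂(stdGaussian V3) +
        ∫ ξ, ⟪ω, lambertDir ω ξ⟫ ^ 2 * ⟪b, lambertDir ω ξ⟫ ^ 2 ∂(stdGaussian V3) := by
  have h1 : ∫ ξ, ⟪ω, lambertDir ω ξ⟫ ^ 2 * ⟪a - b, lambertDir ω ξ⟫ ^ 2 ∂(stdGaussian V3) =
      ∫ ξ, ⟪ω, lambertDir ω ξ⟫ ^ 2 * ⟪a + b, lambertDir ω ξ⟫ ^ 2 ∂(stdGaussian V3) := by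
    rw [← weightedMoment_map L hL (a + b), map_add, ha, hb, ← sub_eq_add_neg]
  have h2 := weightedMoment_add_add_sub ω a b
  rw [h1] at h2
  linarith

/-! ### The values on the frame: `F(ω) = ⅓`, trace `F(e₁) + F(e₂) + F(ω) = ½` -/

/-- The axial value of the weighted quadratic form: `F(ω) = E[⟪ω, n⟫⁴] = ⅓`. [folklore] -/
theorem weightedMoment_self {ω : V3} (hω : ‖ω‖ = 1) :
    ∫ ξ, ⟪ω, lambertDir ω ξ⟫ ^ 2 * ⟪ω, lambertDir ω ξ⟫ ^ 2 ∂(stdGaussian V3) = 3⁻¹ := by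
  have h : ∀ ξ : V3, ⟪ω, lambertDir ω ξ⟫ ^ 2 * ⟪ω, lambertDir ω ξ⟫ ^ 2 =
      ⟪ω, lambertDir ω ξ⟫ ^ 4 := fun ξ => by ring
  simp_rw [h]
  exact stub_lambertFourthMoment_self hω

/-- **Trace identity** for the weighted form: `F(e₁ ω) + F(e₂ ω) + F(ω) = E[⟪ω, n⟫² ‖n‖²] = E[⟪ω, n⟫²]
= ½` for a unit normal `ω` (`‖lambertDir ω ξ‖ = 1` almost surely, `secondMoment_self`). [folklore] -/
theorem weightedMoment_trace {ω : V3} (hω : ‖ω‖ = 1) :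
    ∫ ξ, ⟪ω, lambertDir ω ξ⟫ ^ 2 * ⟪Lambert.e₁ ω, lambertDir ω ξ⟫ ^ 2 ∂(stdGaussian V3) +
        ∫ ξ, ⟪ω, lambertDir ω ξ⟫ ^ 2 * ⟪Lambert.e₂ ω, lambertDir ω ξ⟫ ^ 2 ∂(stdGaussian V3) +
        ∫ ξ, ⟪ω, lambertDir ω ξ⟫ ^ 2 * ⟪ω, lambertDir ω ξ⟫ ^ 2 ∂(stdGaussian V3) = 2⁻¹ := by
  have hsum : Integrable (fun ξ : V3 => ⟪ω, lambertDir ω ξ⟫ ^ 2 * ⟪Lambert.e₁ ω, lambertDir ω ξ⟫ ^ 2 +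
      ⟪ω, lambertDir ω ξ⟫ ^ 2 * ⟪Lambert.e₂ ω, lambertDir ω ξ⟫ ^ 2) (stdGaussian V3) :=
    (weightedMoment_integrable ω ω _).add (weightedMoment_integrable ω ω _)
  rw [← integral_add (weightedMoment_integrable ω ω _) (weightedMoment_integrable ω ω _),
    ← integral_add hsum (weightedMoment_integrable ω ω _)]
  have hfac : ∀ ξ : V3, ⟪ω, lambertDir ω ξ⟫ ^ 2 * ⟪Lambert.e₁ ω, lambertDir ω ξ⟫ ^ 2 +
      ⟪ω, lambertDir ω ξ⟫ ^ 2 * ⟪Lambert.e₂ ω, lambertDir ω ξ⟫ ^ 2 +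
      ⟪ω, lambertDir ω ξ⟫ ^ 2 * ⟪ω, lambertDir ω ξ⟫ ^ 2 =
      ⟪ω, lambertDir ω ξ⟫ ^ 2 * (⟪Lambert.e₁ ω, lambertDir ω ξ⟫ ^ 2 +
        ⟪Lambert.e₂ ω, lambertDir ω ξ⟫ ^ 2 + ⟪ω, lambertDir ω ξ⟫ ^ 2) := fun ξ => by ring
  simp_rw [hfac, sum_sq_inner_frame hω]
  have hae : (fun ξ : V3 => ⟪ω, lambertDir ω ξ⟫ ^ 2 * ‖lambertDir ω ξ‖ ^ 2) =ᵐ[stdGaussian V3]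
      fun ξ => ⟪ω, lambertDir ω ξ⟫ ^ 2 := by
    filter_upwards [ae_stdGaussian_lambertDir_ne_zero_euclideanSpace ω] with ξ h
    rw [norm_lambertDir h, one_pow, mul_one]
  rw [integral_congr_ae hae, secondMoment_self hω]

/-- **Registered stub `stub_lambertWeightedMoment_unit`** (line `Sketch` v8b, crux
stmt-AtomisticToContinuum-12097) — the weighted second moment of the cosine law, unit normal: for `‖ω‖ = 1`
and every `c`, `E[⟪ω, n⟫² ⟪c, n⟫²] = (‖c‖² + 3⟪c, ω⟫²)/12` with `n = lambertDir ω ξ`. Decompose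
`c = ⟪c, ω⟫ ω + ⟪e₁, c⟫ e₁ + ⟪e₂, c⟫ e₂`, split `F` along the reflections negating `e₁`, resp. `e₂` (both
fix `ω`), identify `F(e₁) = F(e₂)` by the reflection swapping them, and use `F(ω) = ⅓`,
`F(e₁) + F(e₂) + F(ω) = ½`. [folklore] -/
theorem stub_lambertWeightedMoment_unit {ω : V3} (hω : ‖ω‖ = 1) (c : V3) :
    ∫ ξ, ⟪ω, lambertDir ω ξ⟫ ^ 2 * ⟪c, lambertDir ω ξ⟫ ^ 2 ∂(stdGaussian V3) =
      12⁻¹ * (‖c‖ ^ 2 + 3 * ⟪c, ω⟫ ^ 2) := by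
  -- the frame
  have h11 : ‖Lambert.e₁ ω‖ = 1 := Lambert.norm_e₁ ω
  have h22 : ‖Lambert.e₂ ω‖ = 1 := Lambert.norm_e₂ hω
  have h12 : ⟪Lambert.e₁ ω, Lambert.e₂ ω⟫ = 0 := Lambert.inner_e₁_e₂ ω
  have h1ω : ⟪Lambert.e₁ ω, ω⟫ = 0 := Lambert.inner_e₁_self ω
  have h2ω : ⟪Lambert.e₂ ω, ω⟫ = 0 := Lambert.inner_e₂_self ω
  -- the three reflections fixing `ω`: negate `e₁`, negate `e₂`, swap `e₁` and `e₂`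
  set R₁ : V3 ≃ₗᵢ[ℝ] V3 := (ℝ ∙ Lambert.e₁ ω)ᗮ.reflection with hR₁
  set R₂ : V3 ≃ₗᵢ[ℝ] V3 := (ℝ ∙ Lambert.e₂ ω)ᗮ.reflection with hR₂
  set R₃ : V3 ≃ₗᵢ[ℝ] V3 := (ℝ ∙ (Lambert.e₁ ω - Lambert.e₂ ω))ᗮ.reflection with hR₃
  have hR₁ω : R₁ ω = ω := Submodule.reflection_mem_subspace_eq_self
    (Submodule.mem_orthogonal_singleton_iff_inner_right.2 h1ω)
  have hR₁e₂ : R₁ (Lambert.e₂ ω) = Lambert.e₂ ω := Submodule.reflection_mem_subspace_eq_self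
    (Submodule.mem_orthogonal_singleton_iff_inner_right.2 h12)
  have hR₁e₁ : R₁ (Lambert.e₁ ω) = -Lambert.e₁ ω :=
    Submodule.reflection_orthogonalComplement_singleton_eq_neg _
  have hR₂ω : R₂ ω = ω := Submodule.reflection_mem_subspace_eq_self
    (Submodule.mem_orthogonal_singleton_iff_inner_right.2 h2ω)
  have hR₂e₂ : R₂ (Lambert.e₂ ω) = -Lambert.e₂ ω :=
    Submodule.reflection_orthogonalComplement_singleton_eq_neg _
  have hR₃ω : R₃ ω = ω := Submodule.reflection_mem_subspace_eq_self
    (Submodule.mem_orthogonal_singleton_iff_inner_right.2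
      (by rw [inner_sub_left, h1ω, h2ω, sub_zero]))
  have hR₃e₁ : R₃ (Lambert.e₁ ω) = Lambert.e₂ ω := Submodule.reflection_sub (by rw [h11, h22])
  -- the values on the frame: `F ω = ⅓`, `F e₁ = F e₂ = 1/12`
  have hQω := weightedMoment_self hω
  have hQ12 : ∫ ξ, ⟪ω, lambertDir ω ξ⟫ ^ 2 * ⟪Lambert.e₂ ω, lambertDir ω ξ⟫ ^ 2 ∂(stdGaussian V3) =
      ∫ ξ, ⟪ω, lambertDir ω ξ⟫ ^ 2 * ⟪Lambert.e₁ ω, lambertDir ω ξ⟫ ^ 2 ∂(stdGaussian V3) := by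
    rw [← hR₃e₁, weightedMoment_map R₃ hR₃ω]
  have htr := weightedMoment_trace hω
  rw [hQ12, hQω] at htr
  have hQ1 : ∫ ξ, ⟪ω, lambertDir ω ξ⟫ ^ 2 * ⟪Lambert.e₁ ω, lambertDir ω ξ⟫ ^ 2 ∂(stdGaussian V3) =
      12⁻¹ := by
    linarith
  -- decomposition of `c` and splitting
  have hc : c = (⟪c, ω⟫ • ω + ⟪Lambert.e₂ ω, c⟫ • Lambert.e₂ ω) +
      ⟪Lambert.e₁ ω, c⟫ • Lambert.e₁ ω := by
    have h := proj_eq_frame hω c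
    rw [sub_eq_iff_eq_add] at h
    exact h.trans (by abel)
  have hsplit₁ := weightedMoment_split (ω := ω)
    (a := ⟪c, ω⟫ • ω + ⟪Lambert.e₂ ω, c⟫ • Lambert.e₂ ω)
    (b := ⟪Lambert.e₁ ω, c⟫ • Lambert.e₁ ω) R₁ hR₁ω
    (by rw [map_add, map_smul, map_smul, hR₁ω, hR₁e₂]) (by rw [map_smul, hR₁e₁, smul_neg])
  have hsplit₂ := weightedMoment_split (ω := ω) (a := ⟪c, ω⟫ • ω)
    (b := ⟪Lambert.e₂ ω, c⟫ • Lambert.e₂ ω) R₂ hR₂ω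
    (by rw [map_smul, hR₂ω]) (by rw [map_smul, hR₂e₂, smul_neg])
  rw [hsplit₂, weightedMoment_smul, weightedMoment_smul, weightedMoment_smul, hQω, hQ12, hQ1]
    at hsplit₁
  -- Parseval for `c`
  have hpars := sum_sq_inner_frame hω c
  rw [real_inner_comm c ω] at hpars
  rw [← hc] at hsplit₁
  rw [hsplit₁]
  linarith

/-- **Registered stub `stub_lambertWeightedMixedMoment_unit`** (line `Sketch` v8b, crux
stmt-AtomisticToContinuum-12097) — the polarised weighted second moment of the cosine law: for `‖ω‖ = 1`
and every `a, c`, `E[⟪ω, n⟫² ⟪a, n⟫⟪c, n⟫] = (⟪a, c⟫ + 3⟪a, ω⟫⟪c, ω⟫)/12` with `n = lambertDir ω ξ`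
(`⟪a, n⟫⟪c, n⟫ = ¼ (⟪a + c, n⟫² − ⟪a − c, n⟫²)` and `stub_lambertWeightedMoment_unit`). [folklore] -/
theorem stub_lambertWeightedMixedMoment_unit {ω : V3} (hω : ‖ω‖ = 1) (a c : V3) :
    ∫ ξ, ⟪ω, lambertDir ω ξ⟫ ^ 2 * (⟪a, lambertDir ω ξ⟫ * ⟪c, lambertDir ω ξ⟫) ∂(stdGaussian V3) =
      12⁻¹ * (⟪a, c⟫ + 3 * (⟪a, ω⟫ * ⟪c, ω⟫)) := by
  have h : ∀ ξ : V3, ⟪ω, lambertDir ω ξ⟫ ^ 2 * (⟪a, lambertDir ω ξ⟫ * ⟪c, lambertDir ω ξ⟫) =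
      4⁻¹ * (⟪ω, lambertDir ω ξ⟫ ^ 2 * ⟪a + c, lambertDir ω ξ⟫ ^ 2 -
        ⟪ω, lambertDir ω ξ⟫ ^ 2 * ⟪a - c, lambertDir ω ξ⟫ ^ 2) := fun ξ => by
    simp only [inner_add_left, inner_sub_left]
    ring
  simp_rw [h]
  rw [integral_const_mul, integral_sub (weightedMoment_integrable ω ω _)
      (weightedMoment_integrable ω ω _), stub_lambertWeightedMoment_unit hω,
    stub_lambertWeightedMoment_unit hω, ← real_inner_self_eq_norm_sq (a + c),
    ← real_inner_self_eq_norm_sq (a - c)]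
  simp only [inner_add_left, inner_add_right, inner_sub_left, inner_sub_right, real_inner_comm a c]
  ring

end Summit.AtomisticToContinuum.HydrodynamicLimit.Theorems.ContactAngleEquidistributionSketch

end
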